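import Literature.NumberTheory.Automorphic.Liu2021.AppendixC.HeckeEndomorphism
import Literature.NumberTheory.Automorphic.HeckeAlgebraStructureConstants
import Literature.NumberTheory.Automorphic.HeckeAlgebraFixedPointsProofs
import HarnessLib

/-!
# [Liu 2021, p. 133 (D.3)] the Hecke endomorphisms `[KgK] ∈ End⁰(A_K)` MULTIPLY like the double cosets: `heckeEnd` is an algebra law

Topic `NumberTheory/Automorphic/Liu2021/AppendixC`; namespaces `Literature.NumberTheory.Automorphic` (§1, generic Hecke pairs) and
`….Liu2021.AppendixC.Sec42Data.HeckeTranslates` (§2–§3).  THEOREMS ONLY (no definition, no named fact, no instance, no `sorry`); PROOF-lane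
sequel of ★ DH1 `HeckeEndomorphism` (p746346) announced there («the algebra law `heckeEnd_mul` is the sequel»); cell hodgecm-mathlib, d6 line,
A-p09 (g13) census `CENSUS-DH1-DH2.A-p09g13.md` §DH1 (hand-over 2026-08-29T21:43:26Z).

Print, [Liu2021] p. 133 (before (D.3)): «We have a homomorphism `C_c^∞(K\G(𝔸^∞)/K, ℚ) → End(A_K)_ℚ` of ℚ-algebras induced by the Hecke actions.»
★ DH1 built its value `heckeEnd K g` on `𝟙_{KgK}` and proved it is THE element of `End⁰(A_K)` acting as the Hecke operator `[KgK]` on `H¹_ét(A_∞)`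
(`eq_heckeEnd`).  This file proves the word «homomorphism»: with the structure constants `c(g, g′; D)` of the Hecke ring
([AndrianovZhuravlev2015] Ch. 3 Lemma 1.5, ★ `heckeAlgebra.doubleCosetOperator_mul_eq_sum_smul`: `T_g T_{g′} = Σ_D c_D T_D`),

  `heckeEnd K g * heckeEnd K g′ = Σ_D c(g, g′; D) • heckeEnd K D`        (`heckeEnd_mul_eq_sum_smul`),

so that the ℚ-span of the `heckeEnd K g` is multiplicatively closed and `Algebra.adjoin ℚ (range heckeEnd) = span ℚ (range heckeEnd)` (DH2's
`heckeImage` is the SPAN, `adjoin_range_heckeEnd_eq_span`).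

PROOF.  Both sides are compared through the faithful `ℓ`-adic realisation `x ↦ [·]_K ∘ ᵗ(V_ℓ^ℚ x)` on `H¹_ét(A_∞)` (★ `Sec42Data.endAlgebra_eq_of_forall_toTower_eq`,
[MumfordAV1970] §19 Thm. 3): `V_ℓ^ℚ` is multiplicative and `ᵗ(·)` reverses the order, so `heckeEnd g * heckeEnd g′` acts as `[Kg′K] ∘ [KgK]`; on the other
hand the right `ℋ(G, K)`-module structure of `V^K` ([Cartier1979] §IV.1, ★ `heckeAlgebra.fixedPointsAlgHom : ℋ(G,K)ᵐᵒᵖ →ₐ End(V^K)`, `op T_g ↦ [KgK]`)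
turns the ring identity `T_g T_{g′} = Σ_D c_D T_D` into the operator identity `[Kg′K] ∘ [KgK] = Σ_D c_D [KDK]` on `K`-fixed vectors (§1, any Hecke pair,
any coefficients, any representation) — the two order reversals cancel, which is why `heckeEnd` is a HOMOMORPHISM for the convolution product, as printed.

CONTENT: §1 (generic) `heckeAlgebra.fixedPointsAlgHom_op_doubleCosetOperator_apply`, `heckeOperator_heckeOperator_apply_eq_sum_smul`; §2
`toTower_dualMap_rationalTateAction_mul`, **`heckeEnd_mul_eq_sum_smul`**; §3 `exists_transversal_level`, `heckeEnd_mul_mem_span`, `mul_mem_span_range_heckeEnd`,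
**`adjoin_range_heckeEnd_eq_span`**.  HC_CM is proved only modulo the 7 printed citations until rung 0 closes; nothing here moves a book.

## References
* [Liu2021] Y. Liu, *Fourier–Jacobi cycles and arithmetic relative trace formula*, Camb. J. Math. 9 (2021): p. 133 (before (D.3)); §4.2 (FJcycle.tex l. 2074).
* [AndrianovZhuravlev2015] A. N. Andrianov, V. G. Zhuravlev, *Modular Forms and Hecke Operators*, Ch. 3 §1.1 Lemma 1.5 (PDF pp. 98–99).
* [Cartier1979] P. Cartier, *Representations of p-adic groups: a survey*, PSPM 33 (1979), §IV.1.
* [Bump1997] D. Bump, *Automorphic Forms and Representations* (1997), §4.2 Prop. 4.2.3.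
* [MumfordAV1970] D. Mumford, *Abelian Varieties*, §19 Thm. 3.
-/

set_option autoImplicit false

noncomputable section

open MulAction MulOpposite CategoryTheory NumberField

/-! ## §1 Generic: the ring law of `ℋ(G, K)` as an identity of Hecke operators on `K`-fixed vectors -/

namespace Literature.NumberTheory.Automorphic

variable {k G : Type*} [CommRing k] [Group G] (K : Subgroup G) [IsHeckeTriple (⊤ : Submonoid G) K K]
  {V : Type*} [AddCommGroup V] [Module k V] (ρ : Representation k G V)

/-- `op T_g` acts on `V^K` by the Hecke operator `[KgK]` (★ `coe_fixedPointsAlgHom_apply` + `T_g [K] = 𝟙_{KgK}` + ★ `liftRep_doubleCosetIndicator`).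
[cite: Cartier1979, §IV.1] [cite: Bump1997, §4.2 (paragraph preceding Prop. 4.2.3)] -/
theorem heckeAlgebra.fixedPointsAlgHom_op_doubleCosetOperator_apply (g : G) (v : ρ.fixedPoints K) :
    (heckeAlgebra.fixedPointsAlgHom K ρ (op (heckeAlgebra.doubleCosetOperator K g)) v : V) = heckeOperator ρ K g v := by
  rw [heckeAlgebra.coe_fixedPointsAlgHom_apply, ← heckeAlgebra.toVector_apply, heckeAlgebra.toVector_doubleCosetOperator,
    heckeAlgebra.liftRep_doubleCosetIndicator]

/-- **`[Kg′K] ∘ [KgK] = Σ_D c(g, g′; D) [KDK]` on `K`-fixed vectors** — the structure-constant identity `T_g T_{g′} = Σ_D c_D T_D` of the Hecke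
ring ([AndrianovZhuravlev2015] Lemma 1.5, ★ `doubleCosetOperator_mul_eq_sum_smul`; `c_D = #{(σ, y) ∈ s′ × s : σ y K = the chosen coset of D}` for
transversals `s, s′` of `KgK/K`, `Kg′K/K`) transported by the right-module structure `ℋ(G,K)ᵐᵒᵖ → End(V^K)` (which reverses the order of factors).
[cite: AndrianovZhuravlev2015, Ch. 3 §1.1 Lemma 1.5 (PDF pp. 98–99)] [cite: Cartier1979, §IV.1] -/
theorem heckeOperator_heckeOperator_apply_eq_sum_smul [DecidableEq (G ⧸ K)] [DecidableEq (HeckeCoset (⊤ : Submonoid G) K K)]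
    (g g' : G) {s s' : Finset G}
    (hs : Set.BijOn (fun y : G => (y : G ⧸ K)) s (orbit K (g : G ⧸ K)))
    (hs' : Set.BijOn (fun y : G => (y : G ⧸ K)) s' (orbit K (g' : G ⧸ K))) {v : V} (hv : v ∈ ρ.fixedPoints K) :
    heckeOperator ρ K g' (heckeOperator ρ K g v) =
      ∑ D ∈ (s' ×ˢ s).image (fun q : G × G => HeckeCoset.mk K K ⟨q.1 * q.2, Submonoid.mem_top _⟩),
        (((s' ×ˢ s).filter fun q : G × G => ((q.1 * q.2 : G) : G ⧸ K) = heckeAlgebra.ofHeckeCoset K D).card : k) •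
          heckeOperator ρ K (heckeAlgebra.ofHeckeCoset K D).out v := by
  have hmul := heckeAlgebra.doubleCosetOperator_mul_eq_sum_smul (k := k) K g g' hs hs'
  have h := congrArg (fun T : heckeAlgebra k G K => ((heckeAlgebra.fixedPointsAlgHom K ρ (op T)) ⟨v, hv⟩ : V)) hmul
  -- left-hand side: `op (T_g T_{g'}) = op T_{g'} * op T_g` acts by `[Kg'K] ∘ [KgK]`
  have hgv : heckeAlgebra.fixedPointsAlgHom K ρ (op (heckeAlgebra.doubleCosetOperator K g)) ⟨v, hv⟩ =
      ⟨heckeOperator ρ K g v, heckeOperator_apply_mem_fixedPoints ρ K g hv (finite_orbit_quotient K g)⟩ :=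
    Subtype.ext (heckeAlgebra.fixedPointsAlgHom_op_doubleCosetOperator_apply K ρ g ⟨v, hv⟩)
  rw [op_mul, map_mul, Module.End.mul_apply, hgv, heckeAlgebra.fixedPointsAlgHom_op_doubleCosetOperator_apply] at h
  rw [h, Finset.op_sum, map_sum, LinearMap.sum_apply, Submodule.coe_sum]
  refine Finset.sum_congr rfl fun D _ => ?_
  rw [op_smul, map_smul, LinearMap.smul_apply, Submodule.coe_smul,
    heckeAlgebra.doubleCosetCoeffEquiv_symm_single_eq_doubleCosetOperator,
    heckeAlgebra.fixedPointsAlgHom_op_doubleCosetOperator_apply]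

end Literature.NumberTheory.Automorphic

/-! ## §2 The algebra law of `heckeEnd` -/

namespace Literature.NumberTheory.Automorphic.Liu2021.AppendixC

open Literature.AlgebraicGeometry.Motives (AbelianVariety)
open Literature.AlgebraicGeometry.Motives.AbelianVariety (rationalTateModuleMap endAlgebra rationalTateAction rationalTateAction_algebraMap)

variable {F E : Type} [Field F] [NumberField F] [IsTotallyReal F] [Field E] [NumberField E] [Algebra F E]
  [IsTotallyComplex E] [Algebra.IsQuadraticExtension F E]
variable {P5 : PropC5Data F E} {isotropicAt : ℕ → Prop}

namespace Sec42Data.HeckeTranslates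

variable {C : Sec42Data P5 isotropicAt} (T : C.HeckeTranslates) (ℓ : ℕ) [Fact ℓ.Prime]

/-- the dual of a scalar multiple, pointwise. [folklore] -/
private theorem dualMap_smul_apply' {V : Type*} [AddCommGroup V] [Module ℚ_[ℓ] V] (c : ℚ_[ℓ]) (f : V →ₗ[ℚ_[ℓ]] V)
    (φ : Module.Dual ℚ_[ℓ] V) : (c • f).dualMap φ = c • f.dualMap φ := by
  ext v
  simp only [LinearMap.dualMap_apply, LinearMap.smul_apply, map_smul, smul_eq_mul]

/-- the dual of a finite sum, pointwise. [folklore] -/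
private theorem dualMap_sum_apply' {V : Type*} [AddCommGroup V] [Module ℚ_[ℓ] V] {ι : Type*} (t : Finset ι)
    (f : ι → V →ₗ[ℚ_[ℓ]] V) (φ : Module.Dual ℚ_[ℓ] V) : (∑ i ∈ t, f i).dualMap φ = ∑ i ∈ t, (f i).dualMap φ := by
  ext v
  simp only [LinearMap.dualMap_apply, LinearMap.sum_apply, map_sum]

/-- `V_ℓ^ℚ` is multiplicative and `ᵗ(·)` reverses the order: `[ᵗV_ℓ^ℚ(x y) φ]_K = [ᵗV_ℓ^ℚ(y) (ᵗV_ℓ^ℚ(x) φ)]_K`. [cite: MumfordAV1970, §19 Thm. 3] -/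
theorem toTower_dualMap_rationalTateAction_mul (K : C5.SmallLevel C.S.K₀) (x y : (C.A K).endAlgebra) (φ : C.etaleH1 ℓ K) :
    C.toTower ℓ K ((rationalTateAction (C.A K) ℓ (x * y)).dualMap φ) =
      C.toTower ℓ K ((rationalTateAction (C.A K) ℓ y).dualMap ((rationalTateAction (C.A K) ℓ x).dualMap φ)) := by
  rw [map_mul, Module.End.mul_eq_comp, ← LinearMap.dualMap_comp_dualMap, LinearMap.comp_apply]

/-- `[ᵗV_ℓ^ℚ(q • x) φ]_K = q • [ᵗV_ℓ^ℚ(x) φ]_K` for a rational scalar `q` (through `algebraMap ℚ`, ★ `rationalTateAction_algebraMap`).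
[cite: MumfordAV1970, §19 Thm. 3] -/
theorem toTower_dualMap_rationalTateAction_rat_smul (K : C5.SmallLevel C.S.K₀) (q : ℚ) (x : (C.A K).endAlgebra) (φ : C.etaleH1 ℓ K) :
    C.toTower ℓ K ((rationalTateAction (C.A K) ℓ (q • x)).dualMap φ) =
      (q : ℚ_[ℓ]) • C.toTower ℓ K ((rationalTateAction (C.A K) ℓ x).dualMap φ) := by
  have hV : rationalTateAction (C.A K) ℓ (q • x) = (q : ℚ_[ℓ]) • rationalTateAction (C.A K) ℓ x := by
    rw [Algebra.smul_def, map_mul, rationalTateAction_algebraMap, ← Algebra.smul_def, eq_ratCast]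
  rw [hV, dualMap_smul_apply', map_smul]

/-- `[ᵗV_ℓ^ℚ(Σᵢ xᵢ) φ]_K = Σᵢ [ᵗV_ℓ^ℚ(xᵢ) φ]_K`. [cite: MumfordAV1970, §19 Thm. 3] -/
theorem toTower_dualMap_rationalTateAction_sum (K : C5.SmallLevel C.S.K₀) {ι : Type*} (t : Finset ι)
    (x : ι → (C.A K).endAlgebra) (φ : C.etaleH1 ℓ K) :
    C.toTower ℓ K ((rationalTateAction (C.A K) ℓ (∑ i ∈ t, x i)).dualMap φ) =
      ∑ i ∈ t, C.toTower ℓ K ((rationalTateAction (C.A K) ℓ (x i)).dualMap φ) := by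
  rw [map_sum, dualMap_sum_apply', map_sum]

/-- **THE ALGEBRA LAW `heckeEnd K g * heckeEnd K g′ = Σ_D c(g, g′; D) • heckeEnd K D`** — «a homomorphism of ℚ-algebras induced by the Hecke
actions» ([Liu2021] p. 133), with the structure constants of [AndrianovZhuravlev2015] Lemma 1.5 read on transversals `s` of `KgK/K` and `s′` of
`Kg′K/K` exactly as in ★ `doubleCosetOperator_mul_eq_sum_smul` (`D` over the double cosets of the products `σ y`, `(σ, y) ∈ s′ × s`;
`c_D = #{(σ, y) : σ y K = the chosen coset of D}`; the representative of `D` is `(ofHeckeCoset K D).out`).  Granted injective étale pull-backs along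
the tower (`hI`, as in ★ `eq_heckeEnd`). [cite: Liu2021, p. 133 (before (D.3)) and §4.2 (FJcycle.tex l. 2074)]
[cite: AndrianovZhuravlev2015, Ch. 3 §1.1 Lemma 1.5 (PDF pp. 98–99)] [cite: MumfordAV1970, §19 Thm. 3] -/
theorem heckeEnd_mul_eq_sum_smul (hD : T.IsogenyDescent)
    (hI : ∀ ⦃K K' : C5.SmallLevel C.S.K₀⦄ (f : K' ⟶ K), Function.Injective (rationalTateModuleMap ℓ (C.Atr f)).dualMap)
    (K : C5.SmallLevel C.S.K₀) [DecidableEq (C.G ⧸ (K.1.1 : Subgroup C.G))]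
    [DecidableEq (HeckeCoset (⊤ : Submonoid C.G) (K.1.1 : Subgroup C.G) (K.1.1 : Subgroup C.G))]
    (g g' : C.G) {s s' : Finset C.G}
    (hs : Set.BijOn (fun y : C.G => (y : C.G ⧸ (K.1.1 : Subgroup C.G))) s (orbit K.1.1 (g : C.G ⧸ (K.1.1 : Subgroup C.G))))
    (hs' : Set.BijOn (fun y : C.G => (y : C.G ⧸ (K.1.1 : Subgroup C.G))) s' (orbit K.1.1 (g' : C.G ⧸ (K.1.1 : Subgroup C.G)))) :
    T.heckeEnd hD K g * T.heckeEnd hD K g' =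
      ∑ D ∈ (s' ×ˢ s).image (fun q : C.G × C.G => HeckeCoset.mk (K.1.1 : Subgroup C.G) (K.1.1 : Subgroup C.G) ⟨q.1 * q.2, Submonoid.mem_top _⟩),
        (((s' ×ˢ s).filter fun q : C.G × C.G =>
            ((q.1 * q.2 : C.G) : C.G ⧸ (K.1.1 : Subgroup C.G)) = heckeAlgebra.ofHeckeCoset (K.1.1 : Subgroup C.G) D).card : ℚ) •
          T.heckeEnd hD K (heckeAlgebra.ofHeckeCoset (K.1.1 : Subgroup C.G) D).out := by
  haveI := Literature.NumberTheory.Automorphic.isHeckeTriple_top_of_isCompact_isOpen (K.1.1 : Subgroup C.G) K.1.2.2 K.1.2.1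
  refine C.endAlgebra_eq_of_forall_toTower_eq ℓ hI K fun φ => ?_
  have hfix : C.toTower ℓ K φ ∈ (T.etHeckeRep ℓ).fixedPoints (K.1.1 : Subgroup C.G) :=
    ((T.etHeckeRep ℓ).mem_fixedPoints K.1.1 (C.toTower ℓ K φ)).2 fun _ hk' => T.etHeckeRep_toTower_of_mem ℓ hk' φ
  -- left: `[Kg'K] ([KgK] [φ]_K)`
  rw [toTower_dualMap_rationalTateAction_mul ℓ K, T.toTower_dualMap_rationalTateAction_heckeEnd ℓ hD K g',
    T.toTower_dualMap_rationalTateAction_heckeEnd ℓ hD K g,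
    Literature.NumberTheory.Automorphic.heckeOperator_heckeOperator_apply_eq_sum_smul (K.1.1 : Subgroup C.G) (T.etHeckeRep ℓ) g g' hs hs' hfix]
  -- right: linearity of `x ↦ [ᵗV_ℓ^ℚ x φ]_K` and ★ DH1 on each `heckeEnd K D`
  rw [toTower_dualMap_rationalTateAction_sum ℓ K]
  refine Finset.sum_congr rfl fun D _ => ?_
  rw [toTower_dualMap_rationalTateAction_rat_smul ℓ K, T.toTower_dualMap_rationalTateAction_heckeEnd ℓ hD K, Rat.cast_natCast]

/-! ## §3 The ℚ-span of the Hecke endomorphisms is a subalgebra: `adjoin = span` -/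

omit [Fact ℓ.Prime] in
/-- Every double coset of a small level has a finite TRANSVERSAL `s ⊆ 𝔾(𝔸_F^∞)` (`K` is compact open). [cite: Bump1997, §4.2 (Prop. 4.2.3, proof)] -/
theorem exists_transversal_level (K : C5.SmallLevel C.S.K₀) (g : C.G) :
    ∃ s : Finset C.G, Set.BijOn (fun y : C.G => (y : C.G ⧸ (K.1.1 : Subgroup C.G))) s (orbit K.1.1 (g : C.G ⧸ (K.1.1 : Subgroup C.G))) := by
  classical
  have hfin := Sec42Data.BettiPinning.finite_orbit_level K g
  refine ⟨hfin.toFinset.image Quotient.out, ?_, ?_, ?_⟩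
  · rintro y hy
    obtain ⟨x, hx, rfl⟩ := Finset.mem_image.1 hy
    show ((Quotient.out x : C.G) : C.G ⧸ (K.1.1 : Subgroup C.G)) ∈ _
    rw [QuotientGroup.out_eq']
    exact hfin.mem_toFinset.1 hx
  · rintro y hy y' hy' h
    obtain ⟨x, -, rfl⟩ := Finset.mem_image.1 hy
    obtain ⟨x', -, rfl⟩ := Finset.mem_image.1 hy'
    change ((Quotient.out x : C.G) : C.G ⧸ (K.1.1 : Subgroup C.G)) = ((Quotient.out x' : C.G) : C.G ⧸ (K.1.1 : Subgroup C.G)) at h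
    rw [QuotientGroup.out_eq', QuotientGroup.out_eq'] at h
    rw [h]
  · intro x hx
    exact ⟨x.out, Finset.mem_image.2 ⟨x, hfin.mem_toFinset.2 hx, rfl⟩, QuotientGroup.out_eq' x⟩

/-- The product of two Hecke endomorphisms lies in the ℚ-span of the Hecke endomorphisms. [cite: Liu2021, p. 133 (before (D.3))]
[cite: AndrianovZhuravlev2015, Ch. 3 §1.1 Lemma 1.5 (PDF pp. 98–99)] -/
theorem heckeEnd_mul_mem_span (hD : T.IsogenyDescent)
    (hI : ∀ ⦃K K' : C5.SmallLevel C.S.K₀⦄ (f : K' ⟶ K), Function.Injective (rationalTateModuleMap ℓ (C.Atr f)).dualMap)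
    (K : C5.SmallLevel C.S.K₀) (g g' : C.G) :
    T.heckeEnd hD K g * T.heckeEnd hD K g' ∈ Submodule.span ℚ (Set.range (T.heckeEnd hD K)) := by
  classical
  obtain ⟨s, hs⟩ := exists_transversal_level (C := C) K g
  obtain ⟨s', hs'⟩ := exists_transversal_level (C := C) K g'
  rw [T.heckeEnd_mul_eq_sum_smul ℓ hD hI K g g' hs hs']
  exact Submodule.sum_mem _ fun D _ => Submodule.smul_mem _ _ (Submodule.subset_span ⟨_, rfl⟩)

/-- The ℚ-span of the Hecke endomorphisms is multiplicatively closed. [cite: Liu2021, p. 133 (before (D.3))] -/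
theorem mul_mem_span_range_heckeEnd (hD : T.IsogenyDescent)
    (hI : ∀ ⦃K K' : C5.SmallLevel C.S.K₀⦄ (f : K' ⟶ K), Function.Injective (rationalTateModuleMap ℓ (C.Atr f)).dualMap)
    (K : C5.SmallLevel C.S.K₀) {x y : (C.A K).endAlgebra}
    (hx : x ∈ Submodule.span ℚ (Set.range (T.heckeEnd hD K))) (hy : y ∈ Submodule.span ℚ (Set.range (T.heckeEnd hD K))) :
    x * y ∈ Submodule.span ℚ (Set.range (T.heckeEnd hD K)) := by
  have hle : Submodule.span ℚ (Set.range (T.heckeEnd hD K)) * Submodule.span ℚ (Set.range (T.heckeEnd hD K)) ≤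
      Submodule.span ℚ (Set.range (T.heckeEnd hD K)) := by
    rw [Submodule.span_mul_span, Submodule.span_le]
    rintro _ ⟨_, ⟨g, rfl⟩, _, ⟨g', rfl⟩, rfl⟩
    exact T.heckeEnd_mul_mem_span ℓ hD hI K g g'
  exact hle (Submodule.mul_mem_mul hx hy)

/-- **`Algebra.adjoin ℚ (range heckeEnd) = span ℚ (range heckeEnd)`** (as submodules of `End⁰(A_K)`): the image of the Hecke algebra at level `K`
(DH2's `heckeImage`) is the ℚ-SPAN of the `[KgK]`, because the span contains `1 = [K]` (★ `heckeEnd_one`) and is multiplicatively closed.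
[cite: Liu2021, p. 133 (before (D.3))] [cite: AndrianovZhuravlev2015, Ch. 3 §1.1 Lemma 1.5 (PDF pp. 98–99)] -/
theorem adjoin_range_heckeEnd_eq_span (hD : T.IsogenyDescent)
    (hI : ∀ ⦃K K' : C5.SmallLevel C.S.K₀⦄ (f : K' ⟶ K), Function.Injective (rationalTateModuleMap ℓ (C.Atr f)).dualMap)
    (K : C5.SmallLevel C.S.K₀) :
    Subalgebra.toSubmodule (Algebra.adjoin ℚ (Set.range (T.heckeEnd hD K))) = Submodule.span ℚ (Set.range (T.heckeEnd hD K)) := by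
  refine le_antisymm ?_ (Algebra.span_le_adjoin ℚ _)
  rw [Algebra.adjoin_eq_span]
  refine Submodule.span_le.2 fun x hx => ?_
  induction hx using Submonoid.closure_induction with
  | mem x hx => exact Submodule.subset_span hx
  | one => rw [← T.heckeEnd_one ℓ hD hI K]; exact Submodule.subset_span ⟨1, rfl⟩
  | mul x y _ _ hx hy => exact T.mul_mem_span_range_heckeEnd ℓ hD hI K hx hy

end Sec42Data.HeckeTranslates

end Literature.NumberTheory.Automorphic.Liu2021.AppendixC
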